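import Summits.BirchSwinnertonDyer.BirchSwinnertonDyer.Theorems.ManinLocalTwoThreeTameTwoIVVeluB
import Summits.BirchSwinnertonDyer.Rank1Residual.ManinAdditive.ShimuraLedger
import HarnessLib

/-!
# Kummer-blindness at `2` on the tame cell is the Kodaira type: every rational `2`-torsion point of a tame `IV*` curve is
# Kummer-blind, none of a tame `IV` curve is (an g14's `KummerBlindAtTwo`; E-an-50's residual = the `IV*` stratum)

Summit `BirchSwinnertonDyer`, route `ManinLocalTwoThree` (cell bsd-f2-manin), deciding crux C2 `ManinOddAtFour`
(stmt-BirchSwinnertonDyer-22967).  On a globally minimal `W = [0, a₂, 0, a₄, a₆]` with a rational `2`-torsion point `(e, 0)` write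
`b = a₂ + e`, `c = a₄ + be` (`y² = (x − e)(x² + bx + c)`); an g14's `KummerBlindAtTwo a₂ a₄ e` is `2 ∣ b ∧ 16 ∣ b² − 4c`.  The
polynomial identity `disc(x³ + a₂x² + a₄x + a₆) = (b² − 4c)·B²` on the root, `B = 3e² + 2a₂e + a₄ = e² + be + c` (the Vélu `B` of
`…VeluTwoDiscriminant`, `…TameTwoIVVeluB.odd_veluB_of_odd_cubicDisc`), and `Δ = 16·disc` give:

* `not_kummerBlindAtTwo_of_IV` / `hasNonBlindRationalTwoTorsion_of_IV` / `not_allRationalTwoTorsionBlind_of_IV` — `4 ∥ N`,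
  `ord₂ Δ_min = 4` (type `IV`): `disc` is odd, so `b` is odd: NO rational `2`-torsion point is Kummer-blind.
* `kummerBlindAtTwo_of_IVstar` / `allRationalTwoTorsionBlind_of_IVstar` — `4 ∥ N`, `ord₂ Δ_min = 8` (type `IV*`): `ord₂ disc = 4` and
  `B` is a `2`-adic unit (`padicValRat_veluB_eq_zero_of_IVstar`, p646508), so `16 ∣ b² − 4c` and `b` is even: EVERY rational `2`-torsion
  point is Kummer-blind.  Hence p3-g6's blind-transfer theorems (`…BlindTransferFourP`: `natAbs_maninConstant₀_eq_of_allBlind_of_four_mul_prime`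
  &c.) apply on the whole tame `IV*` stratum, and an's blind residual E-an-50 at `4 ∥ N` is exactly the `IV*` stratum.

HONEST FRAMING: C2, Manin's conjecture and BSD are not proved.  No definitions, no named facts, no sorry.
References: [SilvermanATAEC1994] IV.9.4 Table 4.1; [SilvermanAEC2009] III.1; HOME/MEMO-an.md §56, §67 (E-an-50, E-an-120).
-/

set_option autoImplicit false
set_option linter.dupNamespace false

noncomputable section

open scoped Classical
open Polynomial WeierstrassCurve
open Summit.BirchSwinnertonDyer.Rank1Residual.ManinAdditive.CuspidalKummer
open Summit.BirchSwinnertonDyer.Rank1Residual.ManinAdditive.ShimuraLedger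

namespace Summit.BirchSwinnertonDyer.BirchSwinnertonDyer.Theorems.ManinLocalTwoThree

/-! ### §1 Integer algebra -/

/-- On an integer root `e` of `x³ + a₂x² + a₄x + a₆`: `disc = ((a₂+e)² − 4(a₄ + (a₂+e)e))·(3e² + 2a₂e + a₄)²`. [folklore] -/
theorem cubicDisc_eq_of_root {a₂ a₄ a₆ e : ℤ} (he : e ^ 3 + a₂ * e ^ 2 + a₄ * e + a₆ = 0) :
    a₂ ^ 2 * a₄ ^ 2 - 4 * a₄ ^ 3 - 4 * a₂ ^ 3 * a₆ + 18 * a₂ * a₄ * a₆ - 27 * a₆ ^ 2 =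
      ((a₂ + e) ^ 2 - 4 * (a₄ + (a₂ + e) * e)) * (3 * e ^ 2 + 2 * a₂ * e + a₄) ^ 2 := by
  linear_combination (-27 * a₆ - 4 * a₂ ^ 3 + 18 * a₂ * a₄ + 27 * (e ^ 3 + a₂ * e ^ 2 + a₄ * e)) * he

/-- Odd discriminant ⟹ `a₂ + e` odd ⟹ not Kummer-blind. [folklore] -/
theorem not_kummerBlindAtTwo_of_odd_cubicDisc {a₂ a₄ a₆ e : ℤ} (he : e ^ 3 + a₂ * e ^ 2 + a₄ * e + a₆ = 0)
    (hodd : ¬ (2 : ℤ) ∣ a₂ ^ 2 * a₄ ^ 2 - 4 * a₄ ^ 3 - 4 * a₂ ^ 3 * a₆ + 18 * a₂ * a₄ * a₆ - 27 * a₆ ^ 2) :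
    ¬ KummerBlindAtTwo a₂ a₄ e := by
  rintro ⟨⟨m, hm⟩, -⟩
  apply hodd
  rw [cubicDisc_eq_of_root he, hm]
  exact ⟨(2 * m ^ 2 - 2 * (a₄ + (m + m) * e)) * (3 * e ^ 2 + 2 * a₂ * e + a₄) ^ 2, by ring⟩

/-- `2⁴ ∣ disc`, `B = 3e² + 2a₂e + a₄` odd ⟹ Kummer-blind (`16 ∣ b² − 4c`, hence `b` even). [folklore] -/
theorem kummerBlindAtTwo_of_sixteen_dvd_cubicDisc {a₂ a₄ a₆ e : ℤ} (he : e ^ 3 + a₂ * e ^ 2 + a₄ * e + a₆ = 0)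
    (h16 : (2 : ℤ) ^ 4 ∣ a₂ ^ 2 * a₄ ^ 2 - 4 * a₄ ^ 3 - 4 * a₂ ^ 3 * a₆ + 18 * a₂ * a₄ * a₆ - 27 * a₆ ^ 2)
    (hB : ¬ (2 : ℤ) ∣ 3 * e ^ 2 + 2 * a₂ * e + a₄) : KummerBlindAtTwo a₂ a₄ e := by
  haveI : Fact (Nat.Prime 2) := ⟨Nat.prime_two⟩
  rw [cubicDisc_eq_of_root he] at h16
  set X : ℤ := (a₂ + e) ^ 2 - 4 * (a₄ + (a₂ + e) * e) with hX
  set B : ℤ := 3 * e ^ 2 + 2 * a₂ * e + a₄ with hBdef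
  have hBne : B ≠ 0 := fun h ↦ hB (h ▸ dvd_zero 2)
  have hB0 : padicValInt 2 B = 0 := padicValInt.eq_zero_of_not_dvd hB
  have h16' : (16 : ℤ) ∣ X := by
    by_cases hX0 : X = 0
    · rw [hX0]; exact dvd_zero _
    have h := (padicValInt_dvd_iff (p := 2) 4 (X * B ^ 2)).mp (by exact_mod_cast h16)
    rcases h with h0 | h4
    · exact absurd h0 (mul_ne_zero hX0 (pow_ne_zero _ hBne))
    · rw [pow_two, padicValInt.mul hX0 (mul_ne_zero hBne hBne), padicValInt.mul hBne hBne, hB0, add_zero, add_zero] at h4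
      have := (padicValInt_dvd_iff (p := 2) 4 X).mpr (Or.inr h4)
      exact_mod_cast this
  refine ⟨?_, h16'⟩
  rcases Int.even_or_odd (a₂ + e) with hb | ⟨m, hm⟩
  · exact hb
  · exfalso
    obtain ⟨n, hn⟩ := h16'
    have hb' : a₂ = 2 * m + 1 - e := by omega
    subst hb'
    have h21 : (2 : ℤ) ∣ 1 := ⟨8 * n - 2 * m ^ 2 - 2 * m + 2 * (a₄ + (2 * m + 1) * e), by linear_combination hn⟩
    omega

/-! ### §2 The tame cell: `IV` is never blind, `IV*` is totally blind -/

/-- **No rational `2`-torsion point of a curve with `ord₂ Δ_min = 4` (e.g. tame `IV`) is Kummer-blind:** `W = [0, a₂, 0, a₄, a₆]`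
globally minimal, `ord₂ Δ_min = 4`, `(e, 0)` a rational `2`-torsion point ⟹ for all integer readings `¬ KummerBlindAtTwo a₂ a₄ e` (the discriminant of the
cubic is odd, so `b = a₂ + e` is odd). [cite: SilvermanATAEC1994, IV.9.4 Table 4.1] -/
theorem not_kummerBlindAtTwo_of_IV (W : WeierstrassCurve ℚ) [W.IsElliptic] [W.IsGloballyMinimal] (ha₁ : W.a₁ = 0)
    (ha₃ : W.a₃ = 0) (hΔ4 : padicValInt 2 W.minimalDiscriminantInt = 4) {e : ℚ} (he : e ^ 3 + W.a₂ * e ^ 2 + W.a₄ * e + W.a₆ = 0)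
    (A₂ A₄ E : ℤ) (hA₂ : (A₂ : ℚ) = W.a₂) (hA₄ : (A₄ : ℚ) = W.a₄) (hE : (E : ℚ) = e) : ¬ KummerBlindAtTwo A₂ A₄ E := by
  haveI : Fact (Nat.Prime 2) := ⟨Nat.prime_two⟩
  set M : WeierstrassCurve ℤ := integralModelInt W with hM
  have hWM : M.map (Int.castRingHom ℚ) = W := map_integralModelInt W
  have h1 : W.a₁ = (M.a₁ : ℚ) := by rw [← hWM, map_a₁, eq_intCast]
  have h2 : W.a₂ = (M.a₂ : ℚ) := by rw [← hWM, map_a₂, eq_intCast]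
  have h3 : W.a₃ = (M.a₃ : ℚ) := by rw [← hWM, map_a₃, eq_intCast]
  have h4a : W.a₄ = (M.a₄ : ℚ) := by rw [← hWM, map_a₄, eq_intCast]
  have h6 : W.a₆ = (M.a₆ : ℚ) := by rw [← hWM, map_a₆, eq_intCast]
  have hM1 : M.a₁ = 0 := by exact_mod_cast (h1.symm.trans ha₁)
  have hM3 : M.a₃ = 0 := by exact_mod_cast (h3.symm.trans ha₃)
  have hA₂' : A₂ = M.a₂ := by exact_mod_cast (hA₂.trans h2)
  have hA₄' : A₄ = M.a₄ := by exact_mod_cast (hA₄.trans h4a)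
  have heZ : E ^ 3 + A₂ * E ^ 2 + A₄ * E + M.a₆ = 0 := by
    have h : ((E ^ 3 + A₂ * E ^ 2 + A₄ * E + M.a₆ : ℤ) : ℚ) = 0 := by
      push_cast; rw [hE, hA₂, hA₄, ← h6]; exact he
    exact_mod_cast h
  -- `Δ_min = Δ(M) = 16·disc`, so `disc` is odd
  set d : ℤ := A₂ ^ 2 * A₄ ^ 2 - 4 * A₄ ^ 3 - 4 * A₂ ^ 3 * M.a₆ + 18 * A₂ * A₄ * M.a₆ - 27 * M.a₆ ^ 2 with hd
  have hMΔ : M.Δ = 16 * d := by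
    rw [hd, hA₂', hA₄']
    simp only [WeierstrassCurve.Δ, WeierstrassCurve.b₂, WeierstrassCurve.b₄, WeierstrassCurve.b₆, WeierstrassCurve.b₈, hM1, hM3]
    ring
  have hmin : W.minimalDiscriminantInt = M.Δ := by
    have h1' : (W.minimalDiscriminantInt : ℚ) = W.Δ := cast_minimalDiscriminantInt W
    have h2' : W.Δ = (M.Δ : ℚ) := by rw [← hWM, map_Δ, eq_intCast]
    exact_mod_cast h1'.trans h2'
  have hMΔne : M.Δ ≠ 0 := by rw [← hmin]; exact minimalDiscriminantInt_ne_zero W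
  have hodd : ¬ (2 : ℤ) ∣ d := by
    rintro ⟨k, hk⟩
    have h32 : ((2 : ℕ) : ℤ) ^ 5 ∣ M.Δ := ⟨k, by rw [hMΔ, hk]; push_cast; ring⟩
    rw [padicValInt_dvd_iff] at h32
    rcases h32 with h0 | h5
    · exact hMΔne h0
    · rw [← hmin, hΔ4] at h5; omega
  exact not_kummerBlindAtTwo_of_odd_cubicDisc heZ hodd

/-- With `ord₂ Δ_min = 4` (tame `IV`) and a rational `2`-torsion point, `HasNonBlindRationalTwoTorsion` holds. [cite: SilvermanATAEC1994, IV.9.4 Table 4.1] -/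
theorem hasNonBlindRationalTwoTorsion_of_IV (W : WeierstrassCurve ℚ) [W.IsElliptic] [W.IsGloballyMinimal] (ha₁ : W.a₁ = 0)
    (ha₃ : W.a₃ = 0) (hΔ4 : padicValInt 2 W.minimalDiscriminantInt = 4) {e : ℚ} (he : e ^ 3 + W.a₂ * e ^ 2 + W.a₄ * e + W.a₆ = 0) :
    HasNonBlindRationalTwoTorsion W :=
  ⟨e, he, fun A₂ A₄ E hA₂ hA₄ hE ↦ not_kummerBlindAtTwo_of_IV W ha₁ ha₃ hΔ4 he A₂ A₄ E hA₂ hA₄ hE⟩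

/-- A curve with `ord₂ Δ_min = 4` (tame `IV`) and a rational `2`-torsion point is NOT totally blind. [cite: SilvermanATAEC1994, IV.9.4 Table 4.1] -/
theorem not_allRationalTwoTorsionBlind_of_IV (W : WeierstrassCurve ℚ) [W.IsElliptic] [W.IsGloballyMinimal] (ha₁ : W.a₁ = 0)
    (ha₃ : W.a₃ = 0) (hΔ4 : padicValInt 2 W.minimalDiscriminantInt = 4) {e : ℚ} (he : e ^ 3 + W.a₂ * e ^ 2 + W.a₄ * e + W.a₆ = 0) :
    ¬ AllRationalTwoTorsionBlind W := by
  intro h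
  obtain ⟨A₂, A₄, E, hA₂, hA₄, hE, hbl⟩ := h e he
  exact not_kummerBlindAtTwo_of_IV W ha₁ ha₃ hΔ4 he A₂ A₄ E hA₂ hA₄ hE hbl

/-- **Every rational `2`-torsion point of a tame `IV*` curve is Kummer-blind:** `W = [0, a₂, 0, a₄, a₆]` globally minimal, `4 ∥ N`,
`ord₂ Δ_min = 8` ⟹ `AllRationalTwoTorsionBlind W` (`ord₂ disc = 4` and the Vélu `B = 3e² + 2a₂e + a₄` is a `2`-adic unit by
`padicValRat_veluB_eq_zero_of_IVstar`, so `16 ∣ b² − 4c`, `b` even).  So p3-g6's blind-transfer theorems apply on the whole tame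
`IV*` stratum. [cite: SilvermanATAEC1994, IV.9.4 Table 4.1] -/
theorem allRationalTwoTorsionBlind_of_IVstar (W : WeierstrassCurve ℚ) [W.IsElliptic] [W.IsGloballyMinimal] (ha₁ : W.a₁ = 0)
    (ha₃ : W.a₃ = 0) (h4 : 2 ^ 2 ∣ W.conductorNorm ℤ) (h8 : ¬ 2 ^ 3 ∣ W.conductorNorm ℤ)
    (hΔ8 : padicValInt 2 W.minimalDiscriminantInt = 8) : AllRationalTwoTorsionBlind W := by
  haveI : Fact (Nat.Prime 2) := ⟨Nat.prime_two⟩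
  intro e he
  set M : WeierstrassCurve ℤ := integralModelInt W with hM
  have hWM : M.map (Int.castRingHom ℚ) = W := map_integralModelInt W
  have h1 : W.a₁ = (M.a₁ : ℚ) := by rw [← hWM, map_a₁, eq_intCast]
  have h2 : W.a₂ = (M.a₂ : ℚ) := by rw [← hWM, map_a₂, eq_intCast]
  have h3 : W.a₃ = (M.a₃ : ℚ) := by rw [← hWM, map_a₃, eq_intCast]
  have h4a : W.a₄ = (M.a₄ : ℚ) := by rw [← hWM, map_a₄, eq_intCast]
  have h6 : W.a₆ = (M.a₆ : ℚ) := by rw [← hWM, map_a₆, eq_intCast]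
  have hM1 : M.a₁ = 0 := by exact_mod_cast (h1.symm.trans ha₁)
  have hM3 : M.a₃ = 0 := by exact_mod_cast (h3.symm.trans ha₃)
  have heQ : e ^ 3 + (M.a₂ : ℚ) * e ^ 2 + (M.a₄ : ℚ) * e + (M.a₆ : ℚ) = 0 := by rw [← h2, ← h4a, ← h6]; exact he
  obtain ⟨E, hE⟩ := Summit.BirchSwinnertonDyer.Rank1Residual.X5.O1.exists_intCast_eq_of_cubic_eq_zero heQ
  have heZ : E ^ 3 + M.a₂ * E ^ 2 + M.a₄ * E + M.a₆ = 0 := by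
    have h : ((E ^ 3 + M.a₂ * E ^ 2 + M.a₄ * E + M.a₆ : ℤ) : ℚ) = 0 := by push_cast; rw [hE]; exact heQ
    exact_mod_cast h
  refine ⟨M.a₂, M.a₄, E, h2.symm, h4a.symm, hE, kummerBlindAtTwo_of_sixteen_dvd_cubicDisc heZ ?_ ?_⟩
  · -- `ord₂ disc = 4`
    set d : ℤ := M.a₂ ^ 2 * M.a₄ ^ 2 - 4 * M.a₄ ^ 3 - 4 * M.a₂ ^ 3 * M.a₆ + 18 * M.a₂ * M.a₄ * M.a₆ - 27 * M.a₆ ^ 2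
      with hd
    have hMΔ : M.Δ = 16 * d := by
      rw [hd]
      simp only [WeierstrassCurve.Δ, WeierstrassCurve.b₂, WeierstrassCurve.b₄, WeierstrassCurve.b₆, WeierstrassCurve.b₈, hM1,
        hM3]
      ring
    have hmin : W.minimalDiscriminantInt = M.Δ := by
      have h1' : (W.minimalDiscriminantInt : ℚ) = W.Δ := cast_minimalDiscriminantInt W
      have h2' : W.Δ = (M.Δ : ℚ) := by rw [← hWM, map_Δ, eq_intCast]
      exact_mod_cast h1'.trans h2'
    have hMΔne : M.Δ ≠ 0 := by rw [← hmin]; exact minimalDiscriminantInt_ne_zero W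
    have hd0 : d ≠ 0 := fun h ↦ hMΔne (by rw [hMΔ, h, mul_zero])
    have hv : padicValInt 2 M.Δ = 8 := by rw [← hmin, hΔ8]
    have h256 : ((2 : ℕ) : ℤ) ^ 8 ∣ M.Δ := (padicValInt_dvd_iff (p := 2) 8 M.Δ).mpr (Or.inr (by rw [hv]))
    rw [hMΔ, show ((2 : ℕ) : ℤ) ^ 8 = 16 * 2 ^ 4 by norm_num] at h256
    exact (mul_dvd_mul_iff_left (by norm_num : (16 : ℤ) ≠ 0)).mp h256
  · -- `B` is a `2`-adic unit
    set q : ℚ := e + W.b₂ / 12 with hq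
    have hqroot : W.Ψ₂Sq.eval (q - W.b₂ / 12) = 0 := by
      rw [hq, add_sub_cancel_right]
      simp only [WeierstrassCurve.Ψ₂Sq, eval_add, eval_mul, eval_pow, eval_C, eval_X, WeierstrassCurve.b₂, WeierstrassCurve.b₄,
        WeierstrassCurve.b₆, ha₁, ha₃]
      linear_combination 4 * he
    have hB := padicValRat_veluB_eq_zero_of_IVstar W h4 h8 hΔ8 q hqroot
    have hBne := velu_two_B_ne_zero W q hqroot
    have hBeq : (3 * q ^ 2 - W.c₄ / 48 : ℚ) = ((3 * E ^ 2 + 2 * M.a₂ * E + M.a₄ : ℤ) : ℚ) := by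
      rw [hq, show W.c₄ = W.b₂ ^ 2 - 24 * W.b₄ from rfl]
      simp only [WeierstrassCurve.b₂, WeierstrassCurve.b₄, ha₁, ha₃]
      push_cast
      rw [hE, ← h2, ← h4a]
      ring
    rw [hBeq, padicValRat.of_int] at hB
    rw [hBeq] at hBne
    have hBZ : (3 * E ^ 2 + 2 * M.a₂ * E + M.a₄ : ℤ) ≠ 0 := by exact_mod_cast hBne
    intro h2dvd
    have := (padicValInt_dvd_iff (p := 2) 1 (3 * E ^ 2 + 2 * M.a₂ * E + M.a₄)).mp (by simpa using h2dvd)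
    rcases this with h0 | h1
    · exact hBZ h0
    · have : (padicValInt 2 (3 * E ^ 2 + 2 * M.a₂ * E + M.a₄) : ℤ) = 0 := by exact_mod_cast hB
      omega

end Summit.BirchSwinnertonDyer.BirchSwinnertonDyer.Theorems.ManinLocalTwoThree

end
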